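import Mathlib
import Summits.Ventures.HodgeRepro.Tier4.Common.AdelicDefs
import Summits.Ventures.HodgeRepro.Tier4.Common.CongruenceAdeles
import Summits.Ventures.HodgeRepro.Tier4.Common.CompactOpenLevel
import Summits.Ventures.HodgeRepro.Tier4.Line4.LevelCosetCongruence

/-!
# Tier4/Line4/IntegerArchBound — (C-L4-TAIL, FINITE-PLACE HALF, the ARCHIMEDEAN READ-OUT): a non-zero element of `N · 𝓞_k`
has absolute value `≥ N` at SOME archimedean place, so the sparse coset `t(γ) ∈ t(γ₀) + N 𝓞_k` of `LevelCosetCongruence`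
puts every `γ ≠ γ₀`-entry at archimedean distance `≥ N` from `γ₀`'s (t4-L1-p4 g4's `hsparse` shape S14820: `c · N ≤ d o`)

Blind re-derivation cell `pub-hodge-repro`, Tier 4 (README §9–§10), seat t4-L1-p3 (prover, gen 3; on L4's finite-place
half by the lead's word S14760).  Target tree path `lean/Summits/Ventures/HodgeRepro/Tier4/Line4/IntegerArchBound.lean`.
Imports this seat's `LevelCosetCongruence` (p698171).  0 printed inputs (Mathlib: `NumberField.InfinitePlace.one_le_of_lt_one`
— the product formula `∏_w |x|_w^{m_w} = |N_{k/ℚ}(x)| ≥ 1` for a non-zero algebraic integer).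

CONTENT.  `exists_infinitePlace_one_le (hz : z ≠ 0) : ∃ w : InfinitePlace k, 1 ≤ w z` (a non-zero algebraic integer is
`≥ 1` at some archimedean place — NOT at a prescribed one: units); `exists_infinitePlace_natCast_le : ∃ w, N ≤ w (N * z)`;
`exists_infinitePlace_natCast_le_of_sub_mem`: for `x - y = N * z`, `z ≠ 0`: `∃ w, N ≤ w (x - y)`; and the read-out on the
coset: **`exists_infinitePlace_natCast_le_entry`** — for rational `γ = κ γ₀ κ'` (`κ, κ' ∈ K(N)`, `γ₀` rational
finite-integral, `N ≠ 0`) and an entry `(i, j)` where the `k`-matrices differ, some archimedean place sees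
`N ≤ |m i j − m₀ i j|_w`.  So with `d(γ) := max_w |t(γ) − t(γ₀)|_w` for an entry-invariant `t`, the level-`N` coset has
`N ≤ d(γ)` off `γ₀` — the `hsparse` of p4's TailAssembly with `c = 1`, ONCE the orbit invariant `t` (`T × T′`-invariant,
`𝓞`-polynomial in the entries) is named; a single prescribed place `w₀` does NOT work over a general `k` (units).
NOT claimed: the invariant `t`, the orbit-level statement, the archimedean decay, `TailDominated`.  Nothing here says
anything about the status of the Hodge conjecture for CM abelian varieties, which is NOT proved (HC_CM is NOT proved by
anyone in this repository).
-/

set_option autoImplicit false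

noncomputable section

namespace Summit.Ventures.HodgeRepro.Tier4.Line4

open Summit.Ventures.HodgeRepro.Tier4.Common NumberField Matrix
open scoped NumberField

section Integers

variable {k : Type} [Field k] [NumberField k]

/-- a non-zero algebraic integer has absolute value `≥ 1` at some archimedean place (product formula). -/
theorem exists_infinitePlace_one_le {z : 𝓞 k} (hz : z ≠ 0) : ∃ w : InfinitePlace k, 1 ≤ w (z : k) := by
  obtain ⟨w₀⟩ : Nonempty (InfinitePlace k) := inferInstance
  by_cases h : ∀ ⦃w : InfinitePlace k⦄, w ≠ w₀ → w (z : k) < 1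
  · exact ⟨w₀, InfinitePlace.one_le_of_lt_one hz h⟩
  · obtain ⟨w, _, hw⟩ : ∃ w : InfinitePlace k, w ≠ w₀ ∧ 1 ≤ w (z : k) := by
      by_contra hcon
      apply h
      intro w hw
      by_contra hlt
      exact hcon ⟨w, hw, not_lt.mp hlt⟩
    exact ⟨w, hw⟩

/-- a non-zero element of `N · 𝓞_k` has absolute value `≥ N` at some archimedean place. -/
theorem exists_infinitePlace_natCast_le (N : ℕ) {z : 𝓞 k} (hz : z ≠ 0) :
    ∃ w : InfinitePlace k, (N : ℝ) ≤ w ((N : k) * (z : k)) := by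
  obtain ⟨w, hw⟩ := exists_infinitePlace_one_le hz
  refine ⟨w, ?_⟩
  rw [map_mul, InfinitePlace.map_natCast]
  calc (N : ℝ) = (N : ℝ) * 1 := (mul_one _).symm
    _ ≤ (N : ℝ) * w (z : k) := mul_le_mul_of_nonneg_left hw (Nat.cast_nonneg N)

/-- if `x - y = N · z` with `z ≠ 0`, some archimedean place has `N ≤ |x - y|_w`. -/
theorem exists_infinitePlace_natCast_le_of_sub_eq {N : ℕ} {x y : k} {z : 𝓞 k} (hz : z ≠ 0)
    (h : x - y = (N : k) * algebraMap (𝓞 k) k z) : ∃ w : InfinitePlace k, (N : ℝ) ≤ w (x - y) := by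
  rw [h]
  exact exists_infinitePlace_natCast_le N hz

end Integers

section Coset

variable {k : Type} [Field k] [NumberField k] (W : PlaneData k)

/-- **THE ARCHIMEDEAN READ-OUT OF THE SPARSE COSET**: for rational `γ = κ γ₀ κ'` with `κ, κ' ∈ K(N)`, `γ₀` rational
finite-integral and `N ≠ 0`, there are `k`-matrices `m, m₀` of `γ, γ₀` such that every entry where they differ is at
archimedean distance `≥ N` at some place: `∀ i j, m i j ≠ m₀ i j → ∃ w : InfinitePlace k, N ≤ w (m i j - m₀ i j)`. -/
theorem exists_infinitePlace_natCast_le_entry {N : ℕ} (hN : N ≠ 0) {κ κ' γ₀ : GA W} (hκ : κ ∈ levelK W N)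
    (hκ' : κ' ∈ levelK W N) (hγ₀ : γ₀ ∈ rationalPoints W) (hint : IsIntegralFin W γ₀)
    (hγ : κ * γ₀ * κ' ∈ rationalPoints W) :
    ∃ m m₀ : Matrix (Fin 4) (Fin 4) k, GA.mat W (κ * γ₀ * κ') = m.map (algebraMap k (Ad k)) ∧
      GA.mat W γ₀ = m₀.map (algebraMap k (Ad k)) ∧
      ∀ i j, m i j ≠ m₀ i j → ∃ w : InfinitePlace k, (N : ℝ) ≤ w (m i j - m₀ i j) := by
  obtain ⟨m, m₀, hm, hm₀, hcong⟩ := entry_sub_mem_N_smul_of_mem_levelK_mul W hN hκ hκ' hγ₀ hint hγ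
  refine ⟨m, m₀, hm, hm₀, fun i j hne => ?_⟩
  obtain ⟨z, hz⟩ := hcong i j
  have hz0 : z ≠ 0 := by
    intro h0
    apply hne
    rw [h0, map_zero, mul_zero, sub_eq_zero] at hz
    exact hz
  exact exists_infinitePlace_natCast_le_of_sub_eq hz0 hz

end Coset

end Summit.Ventures.HodgeRepro.Tier4.Line4
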